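import Summits.CriticalPhenomena.SAWScalingLimit.Theorems.SAWRestrictionRigidityLimitExistsObservablewise
import Summits.CriticalPhenomena.SAWScalingLimit.Theorems.SAWRestrictionRigidityLimitExistsTightNecessity
import Literature.MeasureTheory.Radon.WeakSequentialCompleteness
import HarnessLib

/-!
# `LimitExists` (crux stmt-CriticalPhenomena-1371) — the OBSERVABLE-WISE form of the crux

Route `SAWRestrictionRigidity` of `CriticalPhenomena/SAWScalingLimit`; line `registered`
(`Cruxes/LimitExists/Lines/birth.lean`), lead c3.

`limitExists_iff_eventualTight_and_forall_tendsto_integral` (`…LimitExistsObservablewise`) reads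
`LimitExists ↔ EventualTight ∧ (observable-wise convergence)`.  Here the tightness conjunct is REMOVED: by
the weak sequential completeness of the probability measures on the Polish curve space
(`Literature.MeasureTheory.Radon.exists_finite_forall_eventually_measure_compl_le`, Alexandroff–Varadarajan,
the gliding hump), observable-wise convergence of the pushed critical SAW laws along `δ → 0⁺` already forces
their eventual tightness:

* `exists_isTightMeasureSet_image_of_forall_exists_finite` — finite ball covers of all but `ε` of the pushed
  laws, eventually along `δ → 0⁺`, at every scale ⇒ the `EventualTight` clause (compact containers
  `exists_isCompact_forall_curve_mem_zd` for the meshes bounded away from `0`, a closed totally bounded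
  diagonal intersection — the architecture of `exists_isTightMeasureSet_image_of_tendsto`);
* `exists_isTightMeasureSet_image_of_forall_tendsto_integral`, `eventualTight_of_forall_tendsto_integral` —
  observable-wise convergence ⇒ `EventualTight` (item stmt-CriticalPhenomena-1372);
* **`limitExists_iff_forall_tendsto_integral`** — `LimitExists ↔` for every Dobrushin domain, every endpoint
  approximation and every bounded continuous observable `f` of the curve class, the critical expectations
  `E_δ[f(γ)]` converge along `δ → 0⁺` to SOME real number.  No measure, no tightness, no chordality and no
  cross-approximation consistency remain on the right-hand side: this is the barest form of the crux.

Everything proved, standard axioms. [folklore]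
-/

noncomputable section

open Literature.Probability.RandomPlanarGeometry Literature.Probability.RandomPlanarGeometry.SAW
  Literature.Probability.LatticeModels Literature.Probability MeasureTheory Filter Topology Set
open scoped NNReal ENNReal BoundedContinuousFunction

namespace Summit.CriticalPhenomena.SAWScalingLimit.Theorems.SAWRestrictionRigidityLimitExists

open Summit.CriticalPhenomena.SAWScalingLimit.Theorems.SubseqIdentification.Negative
  (eventually_isProbabilityMeasure_law exists_isCompact_forall_curve_mem_zd)
open Summit.CriticalPhenomena.SAWScalingLimit.Theses.SAWRestrictionRigidity (LimitExists EventualTight)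

variable {D : DobrushinDomain} {a b : ℝ → Site 2}

/-- **Finite ball covers eventually along `δ → 0⁺`, at every scale, force eventual tightness.**  If for every
`ε > 0` and `r > 0` finitely many `r`-balls of the curve space carry all but `ε` of the mass of the pushed
critical SAW laws of `(D; a_δ, b_δ)` for all small `δ`, then for some `δ₀ > 0` the set
`{(P_δ).map curve : δ ∈ (0, δ₀]}` is tight (literally the clause of `EventualTight`): per scale `1/(k+1)` a
finite set of closed balls valid below a threshold `θ_k`, compact containers
(`exists_isCompact_forall_curve_mem_zd`) for the meshes in `[Θ_{k+1}, δ₀]`, and a closed totally bounded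
diagonal intersection. [folklore] -/
theorem exists_isTightMeasureSet_image_of_forall_exists_finite (hab : IsEndpointApprox D a b)
    (hcov : ∀ ε : ℝ≥0∞, 0 < ε → ∀ r : ℝ, 0 < r → ∃ F : Set (CurveClass ℂ), F.Finite ∧
      ∀ᶠ δ in 𝓝[>] (0 : ℝ), ((law D.carrier δ (a δ) (b δ)).map (fun γ => γ.curve))
        (⋃ x ∈ F, Metric.ball x r)ᶜ ≤ ε) :
    ∃ δ₀ : ℝ, 0 < δ₀ ∧ IsTightMeasureSet
      ((fun δ => (law D.carrier δ (a δ) (b δ)).map (fun γ => γ.curve)) '' Set.Ioc 0 δ₀) := by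
  -- adapted from `exists_isTightMeasureSet_image_of_tendsto` (Theorems/…LimitExistsTightNecessity.lean)
  classical
  -- good meshes: probability laws and distinct endpoints, on a fixed interval `(0, δ₁)`
  have hgood : ∀ᶠ δ in 𝓝[>] (0 : ℝ),
      IsProbabilityMeasure (law D.carrier δ (a δ) (b δ)) ∧ a δ ≠ b δ := by
    refine (eventually_isProbabilityMeasure_law hab).and ?_
    have hne : D.pt 0 ≠ D.pt 1 := fun h => absurd (D.pt_injective h) (by decide)
    obtain ⟨U, V, hU, hV, h0U, h1V, hUV⟩ := t2_separation hne
    filter_upwards [hab.tendsto_fst (hU.mem_nhds h0U), hab.tendsto_snd (hV.mem_nhds h1V)]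
      with δ h0 h1 heq
    have h0' : meshPoint δ (b δ) ∈ U := by rw [← heq]; exact h0
    exact Set.disjoint_left.1 hUV h0' h1
  obtain ⟨δ₁, hδ₁, hδ₁sub⟩ := mem_nhdsGT_iff_exists_Ioo_subset.1 hgood
  set δ₀ : ℝ := δ₁ / 2 with hδ₀
  have hδ₀pos : 0 < δ₀ := by rw [hδ₀]; exact half_pos hδ₁
  have hδ₀lt : δ₀ < δ₁ := by rw [hδ₀]; exact half_lt_self hδ₁
  have hgood' : ∀ δ ∈ Set.Ioc (0 : ℝ) δ₀,
      IsProbabilityMeasure (law D.carrier δ (a δ) (b δ)) ∧ a δ ≠ b δ :=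
    fun δ hδ => hδ₁sub ⟨hδ.1, hδ.2.trans_lt hδ₀lt⟩
  refine ⟨δ₀, hδ₀pos, ?_⟩
  rw [isTightMeasureSet_iff_exists_isCompact_measure_compl_le]
  intro ε hε
  obtain ⟨e, hepos, hesum⟩ := ENNReal.exists_pos_sum_of_countable' hε.ne' ℕ
  -- per-level data: finite centres `F k`, threshold `θ k`
  have hlevel : ∀ k : ℕ, ∃ F : Set (CurveClass ℂ), F.Finite ∧ ∃ θ : ℝ, 0 < θ ∧
      ∀ δ ∈ Set.Ioo (0 : ℝ) θ, ((law D.carrier δ (a δ) (b δ)).map (fun γ => γ.curve))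
        (⋃ x ∈ F, Metric.ball x (1 / ((k : ℝ) + 1)))ᶜ ≤ e k := by
    intro k
    obtain ⟨F, hF, hev⟩ := hcov (e k) (hepos k) (1 / ((k : ℝ) + 1)) Nat.one_div_pos_of_nat
    obtain ⟨θ, hθ, hθsub⟩ := mem_nhdsGT_iff_exists_Ioo_subset.1 hev
    exact ⟨F, hF, θ, hθ, fun δ hδ => hθsub hδ⟩
  choose F hF θ hθ hFθ using hlevel
  -- antitone positive thresholds `Θ k = min_{j ≤ k} θ j`
  set Θ : ℕ → ℝ := fun k => (Finset.range (k + 1)).inf' (Finset.nonempty_range_iff.2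
    (Nat.succ_ne_zero k)) θ with hΘ
  have hΘle : ∀ k, Θ k ≤ θ k := fun k =>
    Finset.inf'_le _ (Finset.mem_range.2 (Nat.lt_succ_self k))
  have hΘpos : ∀ k, 0 < Θ k := fun k => (Finset.lt_inf'_iff _).2 fun j _ => hθ j
  have hΘanti : ∀ k, Θ (k + 1) ≤ Θ k := fun k =>
    (Finset.le_inf'_iff _ _).2 fun j hj =>
      Finset.inf'_le _ (Finset.mem_range.2 ((Finset.mem_range.1 hj).trans (Nat.lt_succ_self _)))
  -- compact containers for meshes in `[Θ (k+1), δ₀]`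
  have hC : ∀ k, ∃ C : Set (CurveClass ℂ), IsCompact C ∧ ∀ δ ∈ Set.Icc (Θ (k + 1)) δ₀,
      ∀ u v : Site 2, u ≠ v → ∀ γ : DomainSAW D.carrier δ u v, γ.curve ∈ C := fun k =>
    exists_isCompact_forall_curve_mem_zd D.isBounded (hΘpos (k + 1))
  choose C hCc hCmem using hC
  set ρ : ℕ → ℝ := fun k => 1 / ((k : ℝ) + 1) with hρ
  have hρpos : ∀ k, 0 < ρ k := fun k => Nat.one_div_pos_of_nat
  set A : ℕ → Set (CurveClass ℂ) := fun k => (⋃ x ∈ F k, Metric.closedBall x (ρ k)) ∪ C k with hA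
  have hAclosed : ∀ k, IsClosed (A k) := fun k =>
    ((hF k).isClosed_biUnion fun _ _ => Metric.isClosed_closedBall).union (hCc k).isClosed
  set Kf : Set (CurveClass ℂ) := ⋂ k, A k with hKf
  have hKf_closed : IsClosed Kf := isClosed_iInter hAclosed
  have hKf_tb : TotallyBounded Kf := by
    refine Metric.totallyBounded_iff.2 fun r hr => ?_
    obtain ⟨k, hk⟩ := exists_nat_one_div_lt hr
    obtain ⟨t, htfin, htcov⟩ := Metric.totallyBounded_iff.1 (hCc k).totallyBounded r hr
    refine ⟨F k ∪ t, (hF k).union htfin, fun x hx => ?_⟩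
    have hxA : x ∈ A k := Set.mem_iInter.1 hx k
    rcases hxA with hx1 | hx2
    · obtain ⟨y, hy, hxy⟩ := Set.mem_iUnion₂.1 hx1
      refine Set.mem_biUnion (Or.inl hy) ?_
      rw [Metric.mem_ball]
      exact (Metric.mem_closedBall.1 hxy).trans_lt hk
    · obtain ⟨y, hy, hxy⟩ := Set.mem_iUnion₂.1 (htcov hx2)
      exact Set.mem_biUnion (Or.inr hy) hxy
  have hKf_compact : IsCompact Kf :=
    isCompact_iff_totallyBounded_isComplete.2 ⟨hKf_tb, hKf_closed.isComplete⟩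
  refine ⟨Kf, hKf_compact, ?_⟩
  rintro ν ⟨δ, hδ, rfl⟩
  have hmeas : Measurable (fun γ : DomainSAW D.carrier δ (a δ) (b δ) => γ.curve) :=
    DomainSAW.measurable_of_top _
  rw [Measure.map_apply hmeas hKf_closed.isOpen_compl.measurableSet]
  have hpre : (fun γ : DomainSAW D.carrier δ (a δ) (b δ) => γ.curve) ⁻¹' Kfᶜ =
      ⋃ k, (fun γ : DomainSAW D.carrier δ (a δ) (b δ) => γ.curve) ⁻¹' (A k)ᶜ := by
    simp only [hKf, Set.compl_iInter, Set.preimage_iUnion]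
  rw [hpre]
  refine (measure_iUnion_le _).trans ?_
  have hbound : ∀ k, law D.carrier δ (a δ) (b δ)
      ((fun γ : DomainSAW D.carrier δ (a δ) (b δ) => γ.curve) ⁻¹' (A k)ᶜ) ≤ e k := by
    intro k
    rcases lt_or_ge δ (Θ (k + 1)) with hlt | hle
    · have hδk : δ ∈ Set.Ioo 0 (θ k) := ⟨hδ.1, hlt.trans_le ((hΘanti k).trans (hΘle k))⟩
      have h1 := hFθ k δ hδk
      rw [Measure.map_apply hmeas
        (isOpen_biUnion fun _ _ => Metric.isOpen_ball).isClosed_compl.measurableSet] at h1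
      refine (measure_mono (Set.preimage_mono (Set.compl_subset_compl.2 ?_))).trans h1
      intro x hx
      obtain ⟨y, hy, hxy⟩ := Set.mem_iUnion₂.1 hx
      exact Or.inl (Set.mem_biUnion hy (Metric.ball_subset_closedBall hxy))
    · have hne : a δ ≠ b δ := (hgood' δ hδ).2
      have hempty : (fun γ : DomainSAW D.carrier δ (a δ) (b δ) => γ.curve) ⁻¹' (A k)ᶜ = ∅ :=
        Set.eq_empty_of_forall_notMem fun γ hγ => hγ (Or.inr (hCmem k δ ⟨hle, hδ.2⟩ _ _ hne γ))
      rw [hempty, measure_empty]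
      exact bot_le
  exact (ENNReal.tsum_le_tsum hbound).trans hesum.le

/-- **Observable-wise convergence forces eventual tightness.**  If along the endpoint approximation `(a, b)`
of `D` every bounded continuous observable `f` of the curve class has SOME limit of its critical
expectations `E_δ[f(γ)]` along `δ → 0⁺`, then the pushed critical SAW laws are eventually tight: the pushed
laws are probability measures eventually, so the filter form of the weak sequential completeness of the
probability measures on the Polish space `CurveClass ℂ`
(`Literature.MeasureTheory.Radon.exists_finite_forall_eventually_measure_compl_le`) supplies the finite ball
covers of `exists_isTightMeasureSet_image_of_forall_exists_finite`. [folklore] -/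
theorem exists_isTightMeasureSet_image_of_forall_tendsto_integral (hab : IsEndpointApprox D a b)
    (hO : ∀ f : CurveClass ℂ →ᵇ ℝ, ∃ L : ℝ,
      Tendsto (fun δ => ∫ γ, f γ.curve ∂(law D.carrier δ (a δ) (b δ))) (𝓝[>] (0 : ℝ)) (𝓝 L)) :
    ∃ δ₀ : ℝ, 0 < δ₀ ∧ IsTightMeasureSet
      ((fun δ => (law D.carrier δ (a δ) (b δ)).map (fun γ => γ.curve)) '' Set.Ioc 0 δ₀) := by
  refine exists_isTightMeasureSet_image_of_forall_exists_finite hab fun ε hε r hr => ?_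
  have hprob : ∀ᶠ δ in 𝓝[>] (0 : ℝ),
      IsProbabilityMeasure ((law D.carrier δ (a δ) (b δ)).map (fun γ => γ.curve)) := by
    filter_upwards [eventually_isProbabilityMeasure_law hab] with δ hδ
    haveI := hδ
    exact Measure.isProbabilityMeasure_map (SAW.aemeasurable_curve _ _ _ _)
  have hconv : ∀ f : CurveClass ℂ →ᵇ ℝ, ∃ L : ℝ, Tendsto
      (fun δ => ∫ x, f x ∂((law D.carrier δ (a δ) (b δ)).map (fun γ => γ.curve)))
        (𝓝[>] (0 : ℝ)) (𝓝 L) := by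
    intro f
    obtain ⟨L, hL⟩ := hO f
    refine ⟨L, hL.congr fun δ => ?_⟩
    exact (integral_map (SAW.aemeasurable_curve _ _ _ _) f.continuous.aestronglyMeasurable).symm
  exact Literature.MeasureTheory.Radon.exists_finite_forall_eventually_measure_compl_le hprob hconv hε hr

/-- **Observable-wise convergence ⇒ `EventualTight`** (item stmt-CriticalPhenomena-1372): if for every
Dobrushin domain, every endpoint approximation and every bounded continuous observable the critical
expectations converge along `δ → 0⁺`, the pushed critical SAW laws are eventually tight. [folklore] -/
theorem eventualTight_of_forall_tendsto_integral
    (hO : ∀ (D : DobrushinDomain) (a b : ℝ → Site 2), IsEndpointApprox D a b →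
      ∀ f : CurveClass ℂ →ᵇ ℝ, ∃ L : ℝ,
        Tendsto (fun δ => ∫ γ, f γ.curve ∂(law D.carrier δ (a δ) (b δ))) (𝓝[>] (0 : ℝ)) (𝓝 L)) :
    EventualTight := by
  intro D a b hab
  exact exists_isTightMeasureSet_image_of_forall_tendsto_integral hab (hO D a b hab)

/-- **The observable-wise form of the crux.**  The critical `δℤ²` SAW laws have a full scaling limit as a
chordal curve family (`LimitExists`) IF AND ONLY IF for every Dobrushin domain `D`, every endpoint
approximation `(a, b)` and every bounded continuous observable `f` of the curve class, the critical
expectations `E_δ[f(γ)]` converge along `δ → 0⁺` to some real number.  Backward: observable-wise convergence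
gives eventual tightness (`eventualTight_of_forall_tendsto_integral`, weak sequential completeness on the
Polish curve space) and, with it, the crux (`limitExists_iff_eventualTight_and_forall_tendsto_integral`:
observable-wise limits pin and reconcile all subsequential limits).  Forward: integrate against the limit
law. [folklore] -/
theorem limitExists_iff_forall_tendsto_integral : Summit.CriticalPhenomena.SAWScalingLimit.Theses.SAWRestrictionRigidity.LimitExists ↔ ∀ (D : Literature.Probability.RandomPlanarGeometry.DobrushinDomain) (a b : ℝ → Literature.Probability.LatticeModels.Site 2), Literature.Probability.RandomPlanarGeometry.SAW.IsEndpointApprox D a b → ∀ f : BoundedContinuousFunction (Literature.Probability.RandomPlanarGeometry.CurveClass ℂ) ℝ, ∃ L : ℝ, Filter.Tendsto (fun δ => ∫ γ, f γ.curve ∂(Literature.Probability.RandomPlanarGeometry.SAW.law D.carrier δ (a δ) (b δ))) (nhdsWithin 0 (Set.Ioi 0)) (nhds L) := by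
  constructor
  · intro h
    exact (limitExists_iff_eventualTight_and_forall_tendsto_integral.1 h).2
  · intro hO
    exact limitExists_iff_eventualTight_and_forall_tendsto_integral.2
      ⟨eventualTight_of_forall_tendsto_integral hO, hO⟩

end Summit.CriticalPhenomena.SAWScalingLimit.Theorems.SAWRestrictionRigidityLimitExists

end
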